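import Summits.MatrixMultiplication.MatrixMultiplication.Theorems.AbelianSTPPCensusTAStatEDefs

/-!
# T_A static certificate, range `6380 … 6779` (t*-indexed linear checker with the k-member tree at `τ = 2371/1000`): kernel evaluation, the completeness of the bucket lists, volumes `1501 … (chunk starting 1701)` (small volume chunks: the kernel recursion through the long low-`t` lists is bounded per theorem)

Cell mm-stpp (rung F-M1), tier T_A = «beat `2.371`, the record exponent (ADVXXZ'25 / DEK+26 rounded)»; checker in `AbelianSTPPCensusTAStatEDefs.lean`, table and bucket lists in `AbelianSTPPCensusTAStatEData.lean`
(pattern: theory g12's `AbelianSTPPCensusTAStatDDom*/DCk*.lean`).  `decide` with kernel reduction (standard axioms; no `native_decide`), `Elab.async false`;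
consumed by `TAStatE.checkV_sound` / `TAStatE.domV_sound` / `TAStatE.m2V_sound` in the leaf `AbelianSTPPCensusLeafTA6779Closed.lean`.
WHAT THIS IS NOT: arithmetic on shape lists only; no statement about STPP families or `ω`.
-/

set_option linter.dupNamespace false
set_option autoImplicit false
set_option Elab.async false

namespace Summit.MatrixMultiplication.MatrixMultiplication.Theorems.TAStatE

set_option maxHeartbeats 0 in
/-- Completeness chunk: every sorted candidate shape of the volumes `1501 … 1550` lies in the list of the bucket of its `a·b` (372 shapes). [original] -/
theorem m2c1501 : TAStatE.m2V 50 1501 = true := by decide +kernel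

set_option maxHeartbeats 0 in
/-- Completeness chunk: every sorted candidate shape of the volumes `1551 … 1600` lies in the list of the bucket of its `a·b` (403 shapes). [original] -/
theorem m2c1551 : TAStatE.m2V 50 1551 = true := by decide +kernel

set_option maxHeartbeats 0 in
/-- Completeness chunk: every sorted candidate shape of the volumes `1601 … 1650` lies in the list of the bucket of its `a·b` (372 shapes). [original] -/
theorem m2c1601 : TAStatE.m2V 50 1601 = true := by decide +kernel

set_option maxHeartbeats 0 in
/-- Completeness chunk: every sorted candidate shape of the volumes `1651 … 1700` lies in the list of the bucket of its `a·b` (382 shapes). [original] -/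
theorem m2c1651 : TAStatE.m2V 50 1651 = true := by decide +kernel

set_option maxHeartbeats 0 in
/-- Completeness chunk: every sorted candidate shape of the volumes `1701 … 1750` lies in the list of the bucket of its `a·b` (389 shapes). [original] -/
theorem m2c1701 : TAStatE.m2V 50 1701 = true := by decide +kernel

end Summit.MatrixMultiplication.MatrixMultiplication.Theorems.TAStatE
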